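/-
Copyright (c) 2026 the pub-hodgecm-mathlib formalisation cell (harness21).  Prover seat hodgecm-mathlib-R90-C10-p04 (g3), SLAB R90-TF, section S1 «Ch. 10∕12 local»,
cell «U4-RAM :182 (S-W) wild», brick (W-2′) (dealer R90-C10-plan (g3) R-S1-36 (3) on R90-C10-p02 (g3)'s census `CENSUS-SW-firstbrick.v1.md` f6499a1e §6): THE CONVERSION
(Keys §7 Thm (2) (d)) OVER A UNIFORMISER-FREE DATUM, valid at every non-split place (inert, tame ramified, WILD ramified), crux H413 = `stmt-HodgeConjecture-24833`.
KERNEL module: THEOREMS ONLY (no definition, no named fact, no `sorry`, no instance, no notation).  2026-09-05.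
-/
import Summits.HodgeConjecture.HodgeConjecture.Theorems.R90S1BposRamConversion    -- ★ p863940 (7a) (R90-C10-p06 (g3)): the conversion over (`piU`, `hpiU`, `hB`, `hroot`, `hFε`); brings ★ p862229, ★ `isQuadraticCharExtension_of_forall_norm_of_exists_fixed`, ★ `exists_uniformizer_zpow_mul`
import Summits.HodgeConjecture.HodgeConjecture.Theorems.F0P3cStCharTSTorusRay      -- ★ `exists_uniformizer_units` (a uniformiser unit of `R` exists at EVERY finite place)
import HarnessLib

/-!
# R90-TF S1 «Ch10-local» ∕ U4Keys :182, BRANCH B, (S-W) WILD INFRASTRUCTURE — brick (W-2′): THE CONVERSION OVER A UNIFORMISER-FREE DATUM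
# «`χ₁·‖·‖^{−1∕2}` trivial on every norm `σy·y` + ONE `σ`-fixed unit of absolute value one with `χ₁ ≠ 1` ⟹ `χ₁ = η·‖·‖^{1∕2}`, `η` a quadratic-extension character» — no uniformiser,
# no `|2|_w = 1`, no tameness, no parity of the different   [Keys1984 §7 Thm (2) (d); Rogawski1990 §12.2 (2), §4.8; Serre1979 Ch. V §3]

Cell `pub/hodgecm-mathlib` (D-0151), SLAB R90-TF, section S1 «Ch. 10∕12 local», crux H413 = `stmt-HodgeConjecture-24833` (lane `--supports … --as helper`), route of record
`HCCMUnconditional` (no route verbs); prover seat `hodgecm-mathlib-R90-C10-p04` (g3), brick (W-2′) (HEADS 03:17Z).  THEOREMS ONLY; ★-only imports (no `Lines` import).  NOT THE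
PAYER of :182 ∕ (S-W) ∕ (S-RT) — wild-corner INFRASTRUCTURE (census §6: «the `piU`-free form of (7a)»).

THE POINT.  ★ (7a) `BposRamConversion.exists_eta_of_branchB_of_apply_norm_uniformizer_of_fixedUnit` takes a uniformiser unit `Π = piU` of `R = L ⊗ L⁺_v` (`|Π_{w′}| = exp(−1)`;
NOT assumed skew) together with `hB` («`χ₁(u·σu) = 1` on units of absolute value one») and the root letter `hroot : χ₁(σΠ·Π) = ‖σΠ·Π‖^{1∕2}`.  Such a `Π` EXISTS at every finite place
(★ `F0P3cStCharTSTorusRay.exists_uniformizer_units`), so (7a) already holds at a wild `w ∣ 2` for every different exponent; what the wild road wants is not to CHOOSE `Π` at all.  The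
three letters `{piU + hpiU, hB, hroot}` say exactly ONE choice-free thing: **`hN` — `χ₁(σy·y) = ‖σy·y‖^{1∕2}` for EVERY unit `y` of `R`** (i.e. `η := χ₁·‖·‖^{−1∕2}` kills the norm
group `N(E^×)`).  This file restates the conversion over `hN` (§1), derives `hN` from (7a)'s letters for ANY uniformiser (§2), shows the root letter is independent of the uniformiser
(§3, so the ONE-CURRENCY `X := χ₁(σΠ·Π)` is well defined wherever a `Π` is used), and packages the wild-ready `∃ Π`-form (§4) whose instance at a chosen `Π` is ★ (7a) (junction
`example`).  FRAME = (7a)'s: `(L v) (hns : ∀ w, c • w = w) (w) (hw)`, `σ := conjLocal`, `χ₁ : Rˣ →* ℂˣ` continuous.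
* §1 **`exists_eta_of_apply_norm_eq_halfModulusChar_of_fixedUnit`** `(hN) (hFε)` ⊢ `∃ η, IsQuadraticCharExtension σ η ∧ Continuous η ∧ χ₁ = η · halfModulusChar` (the (S-RT)∕(S-W)
  sockets' second disjunct VERBATIM).
* §2 **`forall_apply_norm_eq_halfModulusChar_of_branchB_of_root`** `(piU hpiU) (hB) (hroot)` ⊢ `hN` (★ `exists_uniformizer_zpow_mul`: `y = Πⁿ·u`).
* §3 **`apply_norm_uniformizer_eq_halfModulusChar_iff`** — for two uniformiser units `Π, Π′`: `hroot(Π) ↔ hroot(Π′)` under `hB` (`Π′ = Π·u`, `|u_{w′}| = 1`).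
* §4 **`exists_eta_of_branchB_of_exists_root_of_fixedUnit`** `(hB) (∃ Π, hpiU ∧ hroot) (hFε)` ⊢ `∃ η, …`; `example`: ★ (7a)'s statement is its instance.
HONEST LABEL.  HC_CM is proved only modulo the 7 printed citations (2 remaining named inputs: hLiu418 = `stmt-HodgeConjecture-24832`, h413 = `stmt-HodgeConjecture-24833`) until rung 0
closes; count-neutral — this file pays NO socket ((S-W), (S-RT), :182, A2′ stay OPEN); no printed citation is discharged; the wild shell law (P-wild-1) that would PRODUCE `hroot`∕`hN`
at a wild place is not addressed; REL ≠ ★ ≠ BUILT.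

## References
* [Keys1984] D. Keys, *Principal series representations of special unitary groups over local fields*, Compositio Math. 51 (1984), §7 Theorem (2) (d) p. 126.
* [Rogawski1990] J. D. Rogawski, *Automorphic Representations of Unitary Groups in Three Variables*, Ann. of Math. Stud. 123 (1990), §12.2 (2) p. 173; §4.8 p. 51.
* [Serre1979] J.-P. Serre, *Local Fields*, GTM 67 (1979), Ch. V §3 Prop. 5 Cor. 3 (norm index two), Ch. XIV §2.
* [WeilBNT1967] A. Weil, *Basic Number Theory* (1967), Ch. I §4 (uniformisers).
-/

set_option autoImplicit false
-- the mandated namespace has the single-problem summit's repeated segment (`HodgeConjecture.HodgeConjecture`)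
set_option linter.dupNamespace false

noncomputable section

open NumberField IsDedekindDomain
open Literature.NumberTheory.Automorphic Literature.NumberTheory.Automorphic.UnitaryGroup
open Summit.HodgeConjecture.HodgeConjecture.Cruxes.H413

namespace Summit.HodgeConjecture.HodgeConjecture.R90.S1.BposRamConversionWild

variable (L : Type) [Field L] [NumberField L] [IsCMField L] (v : HeightOneSpectrum (𝓞 ↥(maximalRealSubfield L)))
  (hns : ∀ w : PlacesOver L v, IsCMField.complexConj L • w.1 = w.1) (w : PlacesOver L v)

/-! ## §1 THE CONVERSION OVER THE UNIFORMISER-FREE DATUM `hN` -/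

/-- **THE CONVERSION (Keys §7 Thm (2) (d)) OVER A UNIFORMISER-FREE DATUM.**  `v` non-split (`hw`), `χ₁ : Rˣ →* ℂˣ` continuous with
**`hN : χ₁(σy·y) = ‖σy·y‖^{1∕2}` for every unit `y` of `R = L ⊗ L⁺_v`** (i.e. `χ₁·‖·‖^{−1∕2}` is trivial on the norms) and the sub-branch letter `hFε` (a `(c ⊗ 1)`-fixed unit
`a` of absolute value one with `χ₁ a ≠ 1`).  Then `∃ η, IsQuadraticCharExtension σ η ∧ Continuous η ∧ χ₁ = η · halfModulusChar`: `η := χ₁·‖·‖^{−1∕2}` kills all norms (`hN`),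
`η a = χ₁ a ≠ 1` (`‖a‖ = 1`), so the norm index is `≤ 2` (★ `isQuadraticCharExtension_of_forall_norm_of_exists_fixed`); continuity and `χ₁ = η·‖·‖^{1∕2}` as in ★ (7a).  NO
uniformiser, NO `|2|_w = 1`, NO ramification or parity hypothesis — valid verbatim at a wild `w ∣ 2`. [cite: Keys1984, §7 Theorem (2) (d) p. 126] [cite: Rogawski1990, §12.2 (2) p. 173; §4.8 p. 51]
[cite: Serre1979, Ch. V §3 Prop. 5 Cor. 3] -/
theorem exists_eta_of_apply_norm_eq_halfModulusChar_of_fixedUnit (hw : IsCMField.complexConj L • w.1 = w.1)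
    (χ₁ : (LocalRing L v)ˣ →* ℂˣ) (h₁ : Continuous (fun x => ((χ₁ x : ℂˣ) : ℂ)))
    (hN : ∀ y : (LocalRing L v)ˣ, χ₁ (Units.map (conjLocal L (IsCMField.complexConj L) v : LocalRing L v →* LocalRing L v) y * y) =
      halfModulusChar (LocalRing L v) (Units.map (conjLocal L (IsCMField.complexConj L) v : LocalRing L v →* LocalRing L v) y * y))
    (hFε : ∃ a : (LocalRing L v)ˣ, Units.map (conjLocal L (IsCMField.complexConj L) v : LocalRing L v →* LocalRing L v) a = a ∧
      (∀ w' : PlacesOver L v, Valued.v ((a : LocalRing L v) w') = 1) ∧ χ₁ a ≠ 1) :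
    ∃ η : (LocalRing L v)ˣ →* ℂˣ, IsQuadraticCharExtension (conjLocal L (IsCMField.complexConj L) v) η ∧
      Continuous (fun x => ((η x : ℂˣ) : ℂ)) ∧ χ₁ = η * halfModulusChar (LocalRing L v) := by
  classical
  set η : (LocalRing L v)ˣ →* ℂˣ := χ₁ * (halfModulusChar (LocalRing L v))⁻¹ with hηdef
  have hηapp : ∀ x, η x = χ₁ x * (halfModulusChar (LocalRing L v) x)⁻¹ := fun x => by rw [hηdef, MonoidHom.mul_apply, MonoidHom.inv_apply]
  -- (i) `η` kills every norm `σ(y)·y` — this IS the datum `hN`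
  have hN' : ∀ y : (LocalRing L v)ˣ, η (Units.map (conjLocal L (IsCMField.complexConj L) v : LocalRing L v →* LocalRing L v) y * y) = 1 := by
    intro y
    rw [hηapp, hN y, mul_inv_cancel]
  -- (ii) `η` is non-trivial on the `σ`-fixed unit of the letter `hFε` (`‖a‖^{1∕2} = 1`)
  have hx : ∃ x₀ : (LocalRing L v)ˣ, conjLocal L (IsCMField.complexConj L) v (x₀ : LocalRing L v) = x₀ ∧ η x₀ ≠ 1 := by
    obtain ⟨a, haσ, ha1, hχa⟩ := hFε
    refine ⟨a, ?_, ?_⟩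
    · have h := congrArg Units.val haσ
      rwa [Units.coe_map, MonoidHom.coe_coe] at h
    · rw [hηapp, halfModulusChar_eq_one_of_forall_v_eq_one L v a ha1, inv_one, mul_one]
      exact hχa
  -- (iii) norm index `≤ 2`, continuity, `χ₁ = η·‖·‖^{1∕2}` (★ (7a) verbatim)
  refine ⟨η, isQuadraticCharExtension_of_forall_norm_of_exists_fixed L v w hw η hN' hx, ?_, ?_⟩
  · have hcont : Continuous fun x : (LocalRing L v)ˣ => ((χ₁ x : ℂˣ) : ℂ) * (((halfModulusChar (LocalRing L v) x : ℂˣ) : ℂ))⁻¹ :=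
      h₁.mul ((continuous_halfModulusChar_apply L v).inv₀ fun x => Units.ne_zero _)
    refine hcont.congr fun x => ?_
    rw [hηapp, Units.val_mul, Units.val_inv_eq_inv_val]
  · exact MonoidHom.ext fun x => by rw [MonoidHom.mul_apply, hηapp, inv_mul_cancel_right]

/-! ## §2 THE DATUM `hN` FROM BRANCH B AND ONE ROOT, FOR ANY UNIFORMISER -/

include hns in
/-- **`hN` FROM `hB` + ONE ROOT, ANY UNIFORMISER.**  For ANY uniformiser unit `Π` of `R` (`|Π_{w′}| = exp(−1)` at every `w′ ∣ v`; `Π` need NOT be skew, and such a `Π` exists at every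
finite place, ★ `exists_uniformizer_units`): Branch B (`hB`) and the root letter `hroot : χ₁(σΠ·Π) = ‖σΠ·Π‖^{1∕2}` give `χ₁(σy·y) = ‖σy·y‖^{1∕2}` for EVERY unit `y` — `y = Πⁿ·u` with
`u` an integral unit (★ `exists_uniformizer_zpow_mul`), `σy·y = (σΠ·Π)ⁿ·(σu·u)`, and `χ₁(σu·u) = 1 = ‖σu·u‖^{1∕2}` (`hB`, ★ `halfModulusChar_eq_one_of_forall_v_eq_one`).  This is ★ (7a)'s
step (i), isolated as the bridge from its letters to §1's datum. [cite: Keys1984, §7 Theorem (2) (d) p. 126] [cite: Rogawski1990, §12.2 (2) p. 173] [cite: WeilBNT1967, Ch. I §4] -/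
theorem forall_apply_norm_eq_halfModulusChar_of_branchB_of_root
    (piU : (LocalRing L v)ˣ) (hpiU : ∀ w' : PlacesOver L v, Valued.v ((piU : LocalRing L v) w') = WithZero.exp (-1 : ℤ))
    (χ₁ : (LocalRing L v)ˣ →* ℂˣ)
    (hB : ∀ u : (LocalRing L v)ˣ, (∀ w' : PlacesOver L v, Valued.v ((u : LocalRing L v) w') = 1) →
      χ₁ (u * Units.map (conjLocal L (IsCMField.complexConj L) v : LocalRing L v →* LocalRing L v) u) = 1)
    (hroot : χ₁ (Units.map (conjLocal L (IsCMField.complexConj L) v : LocalRing L v →* LocalRing L v) piU * piU) =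
      halfModulusChar (LocalRing L v) (Units.map (conjLocal L (IsCMField.complexConj L) v : LocalRing L v →* LocalRing L v) piU * piU)) :
    ∀ y : (LocalRing L v)ˣ, χ₁ (Units.map (conjLocal L (IsCMField.complexConj L) v : LocalRing L v →* LocalRing L v) y * y) =
      halfModulusChar (LocalRing L v) (Units.map (conjLocal L (IsCMField.complexConj L) v : LocalRing L v →* LocalRing L v) y * y) := by
  classical
  intro y
  -- unit-integer currency
  have hmodU : ∀ u : (LocalRing L v)ˣ, (∀ w' : PlacesOver L v, Valued.v ((u : LocalRing L v) w') = 1) → halfModulusChar (LocalRing L v) u = 1 :=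
    fun u hu => halfModulusChar_eq_one_of_forall_v_eq_one L v u hu
  have hσU : ∀ u : (LocalRing L v)ˣ, (∀ w' : PlacesOver L v, Valued.v ((u : LocalRing L v) w') = 1) →
      ∀ w' : PlacesOver L v, Valued.v ((Units.map (conjLocal L (IsCMField.complexConj L) v : LocalRing L v →* LocalRing L v) u : LocalRing L v) w') = 1 := by
    intro u hu w'
    rw [Units.coe_map, MonoidHom.coe_coe, valued_conjLocal_apply_of_smul_eq L v w' (hns w') (u : LocalRing L v)]
    exact hu w'
  -- `y = Πⁿ·u`
  obtain ⟨n, u, hu, hy, -⟩ := K2E3NonUnitaryCharacterDichotomy.exists_uniformizer_zpow_mul L v hns piU hpiU y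
  have hu1 : ∀ w' : PlacesOver L v, Valued.v ((u : LocalRing L v) w') = 1 := (F0P3cStCharTSTorusCompactPart.mem_unitsIntegers_iff L v u).1 hu
  have hNu1 : ∀ w' : PlacesOver L v,
      Valued.v (((Units.map (conjLocal L (IsCMField.complexConj L) v : LocalRing L v →* LocalRing L v) u * u : (LocalRing L v)ˣ) : LocalRing L v) w') = 1 := by
    intro w'
    rw [Units.val_mul, Pi.mul_apply, map_mul, hσU u hu1 w', hu1 w', mul_one]
  have hχNu : χ₁ (Units.map (conjLocal L (IsCMField.complexConj L) v : LocalRing L v →* LocalRing L v) u * u) =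
      halfModulusChar (LocalRing L v) (Units.map (conjLocal L (IsCMField.complexConj L) v : LocalRing L v →* LocalRing L v) u * u) := by
    rw [hmodU _ hNu1, mul_comm]; exact hB u hu1
  have hfact : Units.map (conjLocal L (IsCMField.complexConj L) v : LocalRing L v →* LocalRing L v) y * y =
      (Units.map (conjLocal L (IsCMField.complexConj L) v : LocalRing L v →* LocalRing L v) piU * piU) ^ n *
        (Units.map (conjLocal L (IsCMField.complexConj L) v : LocalRing L v →* LocalRing L v) u * u) := by
    rw [hy, map_mul, map_zpow, mul_mul_mul_comm, ← mul_zpow]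
  rw [hfact, map_mul χ₁, map_zpow χ₁, map_mul (halfModulusChar (LocalRing L v)), map_zpow (halfModulusChar (LocalRing L v)), hroot, hχNu]

/-! ## §3 THE ROOT LETTER DOES NOT DEPEND ON THE UNIFORMISER -/

include hns in
/-- **CHOICE-INDEPENDENCE OF THE ROOT LETTER** (so the ONE-CURRENCY `X := χ₁(σΠ·Π)` is well defined at every place, wild included): for two uniformiser units `Π, Π′` of `R`
(`|Π_{w′}| = |Π′_{w′}| = exp(−1)`), under Branch B: `χ₁(σΠ·Π) = ‖σΠ·Π‖^{1∕2} ↔ χ₁(σΠ′·Π′) = ‖σΠ′·Π′‖^{1∕2}` — indeed `Π′ = Π·u` with `|u_{w′}| = 1`, `σΠ′·Π′ = (σΠ·Π)·(σu·u)` and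
`χ₁(σu·u) = 1 = ‖σu·u‖^{1∕2}`. [cite: Rogawski1990, §12.2 (2) p. 173] [cite: WeilBNT1967, Ch. I §4] -/
theorem apply_norm_uniformizer_eq_halfModulusChar_iff
    (piU piU' : (LocalRing L v)ˣ) (hpiU : ∀ w' : PlacesOver L v, Valued.v ((piU : LocalRing L v) w') = WithZero.exp (-1 : ℤ))
    (hpiU' : ∀ w' : PlacesOver L v, Valued.v ((piU' : LocalRing L v) w') = WithZero.exp (-1 : ℤ))
    (χ₁ : (LocalRing L v)ˣ →* ℂˣ)
    (hB : ∀ u : (LocalRing L v)ˣ, (∀ w' : PlacesOver L v, Valued.v ((u : LocalRing L v) w') = 1) →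
      χ₁ (u * Units.map (conjLocal L (IsCMField.complexConj L) v : LocalRing L v →* LocalRing L v) u) = 1) :
    (χ₁ (Units.map (conjLocal L (IsCMField.complexConj L) v : LocalRing L v →* LocalRing L v) piU * piU) =
        halfModulusChar (LocalRing L v) (Units.map (conjLocal L (IsCMField.complexConj L) v : LocalRing L v →* LocalRing L v) piU * piU)) ↔
      (χ₁ (Units.map (conjLocal L (IsCMField.complexConj L) v : LocalRing L v →* LocalRing L v) piU' * piU') =
        halfModulusChar (LocalRing L v) (Units.map (conjLocal L (IsCMField.complexConj L) v : LocalRing L v →* LocalRing L v) piU' * piU')) := by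
  -- `Π′ = Π·u` with `u := Π⁻¹·Π′` a unit of absolute value one
  set u : (LocalRing L v)ˣ := piU⁻¹ * piU' with hudef
  have he0 : WithZero.exp (-1 : ℤ) ≠ 0 := WithZero.exp_ne_zero
  have hinv : ∀ w' : PlacesOver L v, Valued.v ((((piU⁻¹ : (LocalRing L v)ˣ)) : LocalRing L v) w') = (WithZero.exp (-1 : ℤ))⁻¹ := by
    intro w'
    have h : (piU : LocalRing L v) w' * ((piU⁻¹ : (LocalRing L v)ˣ) : LocalRing L v) w' = 1 := by
      rw [← Pi.mul_apply, Units.mul_inv]; rfl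
    have h' := congrArg Valued.v h
    rw [map_mul, map_one, hpiU w'] at h'
    exact eq_inv_of_mul_eq_one_right h'
  have hu1 : ∀ w' : PlacesOver L v, Valued.v ((u : LocalRing L v) w') = 1 := by
    intro w'
    rw [hudef, Units.val_mul, Pi.mul_apply, map_mul, hinv w', hpiU' w', inv_mul_cancel₀ he0]
  have hσu1 : ∀ w' : PlacesOver L v, Valued.v ((Units.map (conjLocal L (IsCMField.complexConj L) v : LocalRing L v →* LocalRing L v) u : LocalRing L v) w') = 1 := by
    intro w'
    rw [Units.coe_map, MonoidHom.coe_coe, valued_conjLocal_apply_of_smul_eq L v w' (hns w') (u : LocalRing L v)]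
    exact hu1 w'
  have hNu1 : ∀ w' : PlacesOver L v,
      Valued.v (((Units.map (conjLocal L (IsCMField.complexConj L) v : LocalRing L v →* LocalRing L v) u * u : (LocalRing L v)ˣ) : LocalRing L v) w') = 1 := by
    intro w'
    rw [Units.val_mul, Pi.mul_apply, map_mul, hσu1 w', hu1 w', mul_one]
  have hχNu : χ₁ (Units.map (conjLocal L (IsCMField.complexConj L) v : LocalRing L v →* LocalRing L v) u * u) = 1 := by
    rw [mul_comm]; exact hB u hu1
  have hmNu : halfModulusChar (LocalRing L v) (Units.map (conjLocal L (IsCMField.complexConj L) v : LocalRing L v →* LocalRing L v) u * u) = 1 :=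
    halfModulusChar_eq_one_of_forall_v_eq_one L v _ hNu1
  have hpi' : piU' = piU * u := by rw [hudef, mul_inv_cancel_left]
  have hfact : Units.map (conjLocal L (IsCMField.complexConj L) v : LocalRing L v →* LocalRing L v) piU' * piU' =
      (Units.map (conjLocal L (IsCMField.complexConj L) v : LocalRing L v →* LocalRing L v) piU * piU) *
        (Units.map (conjLocal L (IsCMField.complexConj L) v : LocalRing L v →* LocalRing L v) u * u) := by
    rw [hpi', map_mul, mul_mul_mul_comm]
  rw [hfact, map_mul χ₁ (Units.map (conjLocal L (IsCMField.complexConj L) v : LocalRing L v →* LocalRing L v) piU * piU),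
    map_mul (halfModulusChar (LocalRing L v)) (Units.map (conjLocal L (IsCMField.complexConj L) v : LocalRing L v →* LocalRing L v) piU * piU),
    hχNu, hmNu, mul_one, mul_one]

/-! ## §4 THE WILD-READY `∃ Π`-FORM; ★ (7a) IS ITS INSTANCE -/

include hns in
/-- **THE CONVERSION, BRANCH B, ROOT AT SOME UNIFORMISER** — `hB`, `∃ Π` (uniformiser unit) with `χ₁(σΠ·Π) = ‖σΠ·Π‖^{1∕2}`, and `hFε` give `∃ η, IsQuadraticCharExtension σ η ∧ Continuous η ∧
χ₁ = η · halfModulusChar` (§2 then §1).  By §3 the root may be checked at ANY uniformiser, and one exists at every place (★ `exists_uniformizer_units`); no `|2|_w = 1`, no tameness, no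
parity of the different. [cite: Keys1984, §7 Theorem (2) (d) p. 126] [cite: Rogawski1990, §12.2 (2) p. 173; §4.8 p. 51] [cite: Serre1979, Ch. V §3 Prop. 5 Cor. 3] -/
theorem exists_eta_of_branchB_of_exists_root_of_fixedUnit (hw : IsCMField.complexConj L • w.1 = w.1)
    (χ₁ : (LocalRing L v)ˣ →* ℂˣ) (h₁ : Continuous (fun x => ((χ₁ x : ℂˣ) : ℂ)))
    (hB : ∀ u : (LocalRing L v)ˣ, (∀ w' : PlacesOver L v, Valued.v ((u : LocalRing L v) w') = 1) →
      χ₁ (u * Units.map (conjLocal L (IsCMField.complexConj L) v : LocalRing L v →* LocalRing L v) u) = 1)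
    (hroot : ∃ piU : (LocalRing L v)ˣ, (∀ w' : PlacesOver L v, Valued.v ((piU : LocalRing L v) w') = WithZero.exp (-1 : ℤ)) ∧
      χ₁ (Units.map (conjLocal L (IsCMField.complexConj L) v : LocalRing L v →* LocalRing L v) piU * piU) =
        halfModulusChar (LocalRing L v) (Units.map (conjLocal L (IsCMField.complexConj L) v : LocalRing L v →* LocalRing L v) piU * piU))
    (hFε : ∃ a : (LocalRing L v)ˣ, Units.map (conjLocal L (IsCMField.complexConj L) v : LocalRing L v →* LocalRing L v) a = a ∧
      (∀ w' : PlacesOver L v, Valued.v ((a : LocalRing L v) w') = 1) ∧ χ₁ a ≠ 1) :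
    ∃ η : (LocalRing L v)ˣ →* ℂˣ, IsQuadraticCharExtension (conjLocal L (IsCMField.complexConj L) v) η ∧
      Continuous (fun x => ((η x : ℂˣ) : ℂ)) ∧ χ₁ = η * halfModulusChar (LocalRing L v) := by
  obtain ⟨piU, hpiU, hroot⟩ := hroot
  exact exists_eta_of_apply_norm_eq_halfModulusChar_of_fixedUnit L v w hw χ₁ h₁
    (forall_apply_norm_eq_halfModulusChar_of_branchB_of_root L v hns piU hpiU χ₁ hB hroot) hFε

/-- JUNCTION to ★ (7a) p863940: `BposRamConversion.exists_eta_of_branchB_of_apply_norm_uniformizer_of_fixedUnit`'s EXACT binder list and conclusion are the instance of §4 at the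
chosen `Π` — no duplicate theorem; typ1 (g5) seam check. [cite: Keys1984, §7 Theorem (2) (d) p. 126] -/
example (hw : IsCMField.complexConj L • w.1 = w.1)
    (piU : (LocalRing L v)ˣ) (hpiU : ∀ w' : PlacesOver L v, Valued.v ((piU : LocalRing L v) w') = WithZero.exp (-1 : ℤ))
    (χ₁ : (LocalRing L v)ˣ →* ℂˣ) (h₁ : Continuous (fun x => ((χ₁ x : ℂˣ) : ℂ)))
    (hB : ∀ u : (LocalRing L v)ˣ, (∀ w' : PlacesOver L v, Valued.v ((u : LocalRing L v) w') = 1) →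
      χ₁ (u * Units.map (conjLocal L (IsCMField.complexConj L) v : LocalRing L v →* LocalRing L v) u) = 1)
    (hFε : ∃ a : (LocalRing L v)ˣ, Units.map (conjLocal L (IsCMField.complexConj L) v : LocalRing L v →* LocalRing L v) a = a ∧
      (∀ w' : PlacesOver L v, Valued.v ((a : LocalRing L v) w') = 1) ∧ χ₁ a ≠ 1)
    (hroot : χ₁ (Units.map (conjLocal L (IsCMField.complexConj L) v : LocalRing L v →* LocalRing L v) piU * piU) =
      halfModulusChar (LocalRing L v) (Units.map (conjLocal L (IsCMField.complexConj L) v : LocalRing L v →* LocalRing L v) piU * piU)) :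
    ∃ η : (LocalRing L v)ˣ →* ℂˣ, IsQuadraticCharExtension (conjLocal L (IsCMField.complexConj L) v) η ∧
      Continuous (fun x => ((η x : ℂˣ) : ℂ)) ∧ χ₁ = η * halfModulusChar (LocalRing L v) :=
  exists_eta_of_branchB_of_exists_root_of_fixedUnit L v hns w hw χ₁ h₁ hB ⟨piU, hpiU, hroot⟩ hFε

/-- The datum supplier at EVERY finite place (wild included): a uniformiser unit of `R` exists (★ `exists_uniformizer_units`), so §3∕§4 are never vacuous for lack of `Π`. [cite: WeilBNT1967, Ch. I §4] -/
example : ∃ piU : (LocalRing L v)ˣ, ∀ w' : PlacesOver L v, Valued.v ((piU : LocalRing L v) w') = WithZero.exp (-1 : ℤ) :=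
  F0P3cStCharTSTorusRay.exists_uniformizer_units L v

end Summit.HodgeConjecture.HodgeConjecture.R90.S1.BposRamConversionWild

end
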